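import Summits.QuantumFields.YangMills.Theorems.BalabanLadderUVOtherGroupsWitness
import Summits.QuantumFields.YangMills.Theorems.BalabanLadderUVSeamRecSimpleTransport
import Summits.QuantumFields.YangMills.Theorems.BalabanLadderROTGuardIR
import Literature.MathematicalPhysics.QuantumLattice.GaugeGroupsProofs
import HarnessLib

/-!
# Route `BalabanLadder`, crux `UVOtherGroups` (stmt-QuantumFields-19356): the three classes of compact simple groups — unconditional structure

Helper file (`--supports stmt-QuantumFields-19356`, fleet seat `ym-osasm-p2`, director-ym R136 (iii)); pure theorems over the vocabulary
`Theorems/BalabanLadderUVOtherGroupsDefs.lean` (`CeilingsOfFloors`, `UVNonSUN`, `UVSeamWitnessSUN`) and the kernels of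
`Theorems/BalabanLadderUVOtherGroupsSUN.lean` ∕ `…Witness.lean`.  The bridge `Y2Bridge.yangMills_of_legs` splits every compact simple `G`
(`IsCompactSimpleLieGroup G`) into THREE classes — `G ≃ₜ* SU(2)` · `G ≃ₜ* SU(N)` for some `N ≥ 3` · no `G ≃ₜ* SU(N)` at all (`N ≥ 2`) — and
the route owner's R85 batch edit (ym-beyond-p2 g20, `R85-BATCH-EDITS.md` rev 3b, 2026-08-26) replaces the residual leg `UVOtherGroups` by one
residual piece per class beyond the spine's `SU(2)` pair (`UV`, `UVSeamRec`): `UVApexSUN` + `UVSeamWitnessSUN` (the `SU(N ≥ 3)` class, witness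
form) and `UVNonSUNRec` (the third class, record form).  This file records, UNCONDITIONALLY and by name:

* §1 `SU(N)`, `N ≥ 2`, IS a compact simple Lie group — the tree's named fact `isSimpleCompactGroup_specialUnitaryGroup` is DISCHARGED
  (`Literature.MathematicalPhysics.QuantumLattice.isSimpleCompactGroup_specialUnitaryGroup_holds`, `GaugeGroupsProofs.lean`), so the
  lossless reading of the leg (`uvOtherGroups_iff_ceilingsOfFloors_sun_and_nonSUN`, §8 of the kernels file, stated there modulo that fact)
  holds outright: `UVOtherGroups ↔ (∀ N ≥ 3, CeilingsOfFloors SU(N)) ∧ UVNonSUN`; and every member of an `SU(N)` class is admissible.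
* §2 the class trichotomy (logic) — the case split used by `closes`, `yangMills_of_witnessSplit`, `yangMills_of_recordSplit`, once, by name.
* §3 the bridge's UV-side input in record form, «for every compact simple `G` SOME `(r, a)` carries floors ∧ ceilings», is EQUIVALENT to the
  conjunction of its three class components (`SU(2)` class · `SU(N)` itself for every `N ≥ 3` · the non-`SU(N)` class) — Haar transport
  (`legsWitness_of_continuousMulEquiv`) and §1; hence the two witness-form residual pieces of the edit are NECESSARY for the bridge input
  (no over-reach: `uvSeamWitnessSUN_of_legsWitnessAll`, `nonSUNRec_of_legsWitnessAll`) and, with the spine's `UV` + `UVSeamRec` and the apex keys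
  `∀ N ≥ 3, UVD59 N`, SUFFICIENT (`legsWitnessAll_of_recordSplit` — the owner's pre-certified `legs_of_items`, here in the tree).
* §4 the deciding-theorem body of the edit with `ROT` rev 2 (infrared guard, binder shape of `Theorems.ROT.closes_of_rotIR`):
  `yangMills_of_recordSplit_rotIR` — seven binders, `NT`-free; monotone from today's items (`yangMills_of_recordSplit_rotIR_of_current`).

HONEST FRAMING: structure only.  Nothing of Bałaban's programme, no seam, no floor and no residual is asserted or discharged; every leg
hypothesis stays OPEN.  Knits of a CONDITIONAL chain; not a gap, not Clay.
Refs: Bröcker–tom Dieck 1985 V (7.13), (8.1) (simplicity of `SU(n)`); Curtis 1984 VII §C Prop. 9 (centres); folklore (Haar transport).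
-/

set_option autoImplicit false

noncomputable section

open MeasureTheory Filter Topology
open Literature.MathematicalPhysics.QuantumFieldTheory Literature.MathematicalPhysics.QuantumLattice
open Summit.QuantumFields.YangMills.Cruxes.OSLegsFromFemtoAndGap.DlrCollarTransfer
open Summit.QuantumFields.YangMills.Cruxes.UVSeamRec.Transport
open Summit.QuantumFields.YangMills.Cruxes.OSLegsAtWeakCouplingC.Y2Bridge (LatticeRotWard yangMills_of_legs)

namespace Summit.QuantumFields.YangMills.Theorems.UVOtherGroups

/-! ## §1 `SU(N)` is a compact simple Lie group — unconditionally -/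

/- `SU(N)`, `N ≥ 2`, IS a compact simple Lie group — UNCONDITIONALLY: the tree's named fact `isSimpleCompactGroup_specialUnitaryGroup`
(Bröcker–tom Dieck V (7.13)) is discharged by `isSimpleCompactGroup_specialUnitaryGroup_holds` (`GaugeGroupsProofs.lean`), so the term
`isCompactSimpleLieGroup_specialUnitaryGroup isSimpleCompactGroup_specialUnitaryGroup_holds hN` is used inline below (a named copy exists as
`Theorems.FemtoCurvatureTwoPoint.Negative.UnfaithfulFalseSU.isCompactSimpleLieGroup_su`; not imported to keep this file's closure small). -/

/-- **Every member of an `SU(N)` class is admissible**: a compact group `G ≃ₜ* SU(N)`, `N ≥ 2`, is a compact simple Lie group (transport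
`UVSeamRec.SimpleTransport.isCompactSimpleLieGroup_of_continuousMulEquiv` along `e.symm`).  So on the two `SU`-classes the bridge's guard
`IsCompactSimpleLieGroup G` is automatic. -/
theorem isCompactSimpleLieGroup_of_equiv_sun {G : Type} [Group G] [TopologicalSpace G] [IsTopologicalGroup G] [CompactSpace G]
    {N : ℕ} (hN : 2 ≤ N) (e : G ≃ₜ* Matrix.specialUnitaryGroup (Fin N) ℂ) : IsCompactSimpleLieGroup G :=
  Summit.QuantumFields.YangMills.Cruxes.UVSeamRec.SimpleTransport.isCompactSimpleLieGroup_of_continuousMulEquiv e.symm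
    (isCompactSimpleLieGroup_specialUnitaryGroup isSimpleCompactGroup_specialUnitaryGroup_holds hN)

/-- **THE SPLIT IS LOSSLESS — unconditionally** (supersedes the conditional `uvOtherGroups_iff_ceilingsOfFloors_sun_and_nonSUN_of_fact` of the
kernels file §8, whose docstring calls the simplicity fact "unproved": it is proved in the tree): the residual leg `UVOtherGroups` is EQUIVALENT
to «`CeilingsOfFloors SU(N)` for every `N ≥ 3`» ∧ «the non-`SU(N)` residual `UVNonSUN`».  In particular the representation over-reach (∀ `r`)
and the calibration window (∀ `a`) located in the Defs file §3 are the ITEM's own content, not artefacts of the split. -/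
theorem uvOtherGroups_iff_ceilingsOfFloors_sun_and_nonSUN_holds :
    Summit.QuantumFields.YangMills.Theses.BalabanLadder.UVOtherGroups ↔
      (∀ (N : ℕ) [NeZero N], 3 ≤ N → CeilingsOfFloors (Matrix.specialUnitaryGroup (Fin N) ℂ)) ∧ UVNonSUN :=
  uvOtherGroups_iff_ceilingsOfFloors_sun_and_nonSUN fun _ hN =>
    isCompactSimpleLieGroup_specialUnitaryGroup isSimpleCompactGroup_specialUnitaryGroup_holds (by omega)

/-- **The leg gives the `SU(N)` seam's conclusion for every `N ≥ 3` — unconditionally** (`ceilingsOfFloors_sun_of_uvOtherGroups` with the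
simplicity guard discharged). -/
theorem ceilingsOfFloors_sun_of_uvOtherGroups_holds (h : Summit.QuantumFields.YangMills.Theses.BalabanLadder.UVOtherGroups) {N : ℕ}
    (hN : 3 ≤ N) : CeilingsOfFloors (Matrix.specialUnitaryGroup (Fin N) ℂ) :=
  ceilingsOfFloors_sun_of_uvOtherGroups h hN
    (isCompactSimpleLieGroup_specialUnitaryGroup isSimpleCompactGroup_specialUnitaryGroup_holds (by omega))

/-! ## §2 The class trichotomy -/

/-- **Trichotomy of the bridge's case split** (logic only): a topological group `G` admits a topological-group isomorphism onto `SU(2)`,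
or onto some `SU(N)` with `N ≥ 3`, or onto no `SU(N)` with `N ≥ 2`.  (The first two classes are disjoint by the centre,
`Literature.LinearAlgebra.Matrix.isEmpty_continuousMulEquiv_two_of_continuousMulEquiv_specialUnitaryGroup`; the third is disjoint from both
by definition.) -/
theorem suClass_trichotomy (G : Type) [Group G] [TopologicalSpace G] :
    Nonempty (G ≃ₜ* Matrix.specialUnitaryGroup (Fin 2) ℂ) ∨
      (∃ N : ℕ, 3 ≤ N ∧ Nonempty (G ≃ₜ* Matrix.specialUnitaryGroup (Fin N) ℂ)) ∨
      (∀ N : ℕ, 2 ≤ N → IsEmpty (G ≃ₜ* Matrix.specialUnitaryGroup (Fin N) ℂ)) := by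
  by_cases h2 : Nonempty (G ≃ₜ* Matrix.specialUnitaryGroup (Fin 2) ℂ)
  · exact Or.inl h2
  by_cases hex : ∃ N : ℕ, 2 ≤ N ∧ Nonempty (G ≃ₜ* Matrix.specialUnitaryGroup (Fin N) ℂ)
  · obtain ⟨N, hN2, hne⟩ := hex
    have hN3 : 3 ≤ N := by
      by_contra hlt
      obtain rfl : N = 2 := by omega
      exact h2 hne
    exact Or.inr (Or.inl ⟨N, hN3, hne⟩)
  · exact Or.inr (Or.inr fun N hN => ⟨fun e => hex ⟨N, hN, ⟨e⟩⟩⟩)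

/-- In the `SU(N ≥ 3)` class the `SU(2)` guard of the leg holds: `G ≃ₜ* SU(N)`, `N ≥ 3` ⇒ no `G ≃ₜ* SU(2)` (centre `ℤ/N` vs `ℤ/2`). -/
theorem isEmpty_equiv_su2_of_equiv_sun {G : Type} [Group G] [TopologicalSpace G] {N : ℕ} (hN : 3 ≤ N)
    (e : G ≃ₜ* Matrix.specialUnitaryGroup (Fin N) ℂ) : IsEmpty (G ≃ₜ* Matrix.specialUnitaryGroup (Fin 2) ℂ) :=
  Literature.LinearAlgebra.Matrix.isEmpty_continuousMulEquiv_two_of_continuousMulEquiv_specialUnitaryGroup hN e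

/-! ## §3 The bridge's UV-side input in record form = its three class components -/

/-- **Component extraction, `SU(N)` itself**: the all-groups legs witness («for every compact simple `G`, some `(r, a)` carries floors ∧
ceilings») gives the witness AT `SU(N)` for every `N ≥ 2` — unconditionally, `SU(N)` being a compact simple Lie group (§1); the tree's Borel
instances on `SU(N)` are `borel _` ∕ `⟨rfl⟩` definitionally. -/
theorem legsWitness_sun_of_legsWitnessAll
    (h : ∀ (G : Type) [Group G] [TopologicalSpace G] [IsTopologicalGroup G] [CompactSpace G],
      IsCompactSimpleLieGroup G → letI : MeasurableSpace G := borel G; haveI : BorelSpace G := ⟨rfl⟩;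
      ∃ (r : LatticeRep G) (a : ℝ → ℝ), (∀ β, 0 < a β) ∧ Tendsto a atTop (𝓝 0) ∧ LowerBounds G r a ∧ MomentBounds6 G r a)
    {N : ℕ} (hN : 2 ≤ N) :
    ∃ (r : LatticeRep (Matrix.specialUnitaryGroup (Fin N) ℂ)) (a : ℝ → ℝ), (∀ β, 0 < a β) ∧ Tendsto a atTop (𝓝 0) ∧
      LowerBounds (Matrix.specialUnitaryGroup (Fin N) ℂ) r a ∧ MomentBounds6 (Matrix.specialUnitaryGroup (Fin N) ℂ) r a :=
  h (Matrix.specialUnitaryGroup (Fin N) ℂ) (isCompactSimpleLieGroup_specialUnitaryGroup isSimpleCompactGroup_specialUnitaryGroup_holds hN)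

/-- **`UVSeamWitnessSUN` is NECESSARY for the bridge input** (no over-reach of the adopted witness piece): the all-groups legs witness implies
`UVSeamWitnessSUN` (its apex hypothesis `UVD59 N` is not even used). -/
theorem uvSeamWitnessSUN_of_legsWitnessAll
    (h : ∀ (G : Type) [Group G] [TopologicalSpace G] [IsTopologicalGroup G] [CompactSpace G],
      IsCompactSimpleLieGroup G → letI : MeasurableSpace G := borel G; haveI : BorelSpace G := ⟨rfl⟩;
      ∃ (r : LatticeRep G) (a : ℝ → ℝ), (∀ β, 0 < a β) ∧ Tendsto a atTop (𝓝 0) ∧ LowerBounds G r a ∧ MomentBounds6 G r a) :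
    UVSeamWitnessSUN :=
  fun _ _ hN _ => legsWitness_sun_of_legsWitnessAll h (by omega)

/-- **The non-`SU(N)` record residual is NECESSARY for the bridge input**: the all-groups legs witness implies the record-form residual of the
third class (the R85 edit's `UVNonSUNRec`, stated inline — the decl name is the route owner's). -/
theorem nonSUNRec_of_legsWitnessAll
    (h : ∀ (G : Type) [Group G] [TopologicalSpace G] [IsTopologicalGroup G] [CompactSpace G],
      IsCompactSimpleLieGroup G → letI : MeasurableSpace G := borel G; haveI : BorelSpace G := ⟨rfl⟩;
      ∃ (r : LatticeRep G) (a : ℝ → ℝ), (∀ β, 0 < a β) ∧ Tendsto a atTop (𝓝 0) ∧ LowerBounds G r a ∧ MomentBounds6 G r a) :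
    ∀ (G : Type) [Group G] [TopologicalSpace G] [IsTopologicalGroup G] [CompactSpace G],
      IsCompactSimpleLieGroup G → (∀ N : ℕ, 2 ≤ N → IsEmpty (G ≃ₜ* Matrix.specialUnitaryGroup (Fin N) ℂ)) →
      letI : MeasurableSpace G := borel G; haveI : BorelSpace G := ⟨rfl⟩;
      ∃ (r : LatticeRep G) (a : ℝ → ℝ), (∀ β, 0 < a β) ∧ Tendsto a atTop (𝓝 0) ∧ LowerBounds G r a ∧ MomentBounds6 G r a :=
  fun G _ _ _ _ hG _ => h G hG

/-- **The all-groups legs witness from its three class components** (sufficiency): the `SU(2)`-class component, the witness AT `SU(N)` for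
every `N ≥ 3` (transported along `G ≃ₜ* SU(N)` by Haar uniqueness, `legsWitness_of_continuousMulEquiv`) and the non-`SU(N)` record residual
give the witness for every compact simple `G` (trichotomy §2). -/
theorem legsWitnessAll_of_classes
    (h₂ : ∀ (G : Type) [Group G] [TopologicalSpace G] [IsTopologicalGroup G] [CompactSpace G],
      IsCompactSimpleLieGroup G → Nonempty (G ≃ₜ* Matrix.specialUnitaryGroup (Fin 2) ℂ) →
      letI : MeasurableSpace G := borel G; haveI : BorelSpace G := ⟨rfl⟩;
      ∃ (r : LatticeRep G) (a : ℝ → ℝ), (∀ β, 0 < a β) ∧ Tendsto a atTop (𝓝 0) ∧ LowerBounds G r a ∧ MomentBounds6 G r a)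
    (hN : ∀ (N : ℕ) [NeZero N], 3 ≤ N →
      ∃ (r : LatticeRep (Matrix.specialUnitaryGroup (Fin N) ℂ)) (a : ℝ → ℝ), (∀ β, 0 < a β) ∧ Tendsto a atTop (𝓝 0) ∧
        LowerBounds (Matrix.specialUnitaryGroup (Fin N) ℂ) r a ∧ MomentBounds6 (Matrix.specialUnitaryGroup (Fin N) ℂ) r a)
    (hNon : ∀ (G : Type) [Group G] [TopologicalSpace G] [IsTopologicalGroup G] [CompactSpace G],
      IsCompactSimpleLieGroup G → (∀ N : ℕ, 2 ≤ N → IsEmpty (G ≃ₜ* Matrix.specialUnitaryGroup (Fin N) ℂ)) →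
      letI : MeasurableSpace G := borel G; haveI : BorelSpace G := ⟨rfl⟩;
      ∃ (r : LatticeRep G) (a : ℝ → ℝ), (∀ β, 0 < a β) ∧ Tendsto a atTop (𝓝 0) ∧ LowerBounds G r a ∧ MomentBounds6 G r a) :
    ∀ (G : Type) [Group G] [TopologicalSpace G] [IsTopologicalGroup G] [CompactSpace G],
      IsCompactSimpleLieGroup G → letI : MeasurableSpace G := borel G; haveI : BorelSpace G := ⟨rfl⟩;
      ∃ (r : LatticeRep G) (a : ℝ → ℝ), (∀ β, 0 < a β) ∧ Tendsto a atTop (𝓝 0) ∧ LowerBounds G r a ∧ MomentBounds6 G r a := by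
  intro G _ _ _ _ hG
  letI : MeasurableSpace G := borel G
  haveI : BorelSpace G := ⟨rfl⟩
  rcases suClass_trichotomy G with hcl | ⟨N, hN3, ⟨e⟩⟩ | hno
  · exact h₂ G hG hcl
  · haveI : NeZero N := ⟨by omega⟩
    exact legsWitness_of_continuousMulEquiv e (hN N hN3)
  · exact hNon G hG hno

/-- **The bridge's UV-side input in record form IS the conjunction of its three class components** — `SU(2)` class · `SU(N)` itself for every
`N ≥ 3` · non-`SU(N)` record residual — unconditionally.  This is the exact sense in which the R85 cut of the residual class (witness piece
for `SU(N ≥ 3)`, record piece for the rest, beside the spine's `SU(2)` pair) neither loses nor over-reaches in Y2 currency. -/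
theorem legsWitnessAll_iff_classes :
    (∀ (G : Type) [Group G] [TopologicalSpace G] [IsTopologicalGroup G] [CompactSpace G],
      IsCompactSimpleLieGroup G → letI : MeasurableSpace G := borel G; haveI : BorelSpace G := ⟨rfl⟩;
      ∃ (r : LatticeRep G) (a : ℝ → ℝ), (∀ β, 0 < a β) ∧ Tendsto a atTop (𝓝 0) ∧ LowerBounds G r a ∧ MomentBounds6 G r a) ↔
    (∀ (G : Type) [Group G] [TopologicalSpace G] [IsTopologicalGroup G] [CompactSpace G],
      IsCompactSimpleLieGroup G → Nonempty (G ≃ₜ* Matrix.specialUnitaryGroup (Fin 2) ℂ) →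
      letI : MeasurableSpace G := borel G; haveI : BorelSpace G := ⟨rfl⟩;
      ∃ (r : LatticeRep G) (a : ℝ → ℝ), (∀ β, 0 < a β) ∧ Tendsto a atTop (𝓝 0) ∧ LowerBounds G r a ∧ MomentBounds6 G r a) ∧
    (∀ (N : ℕ) [NeZero N], 3 ≤ N →
      ∃ (r : LatticeRep (Matrix.specialUnitaryGroup (Fin N) ℂ)) (a : ℝ → ℝ), (∀ β, 0 < a β) ∧ Tendsto a atTop (𝓝 0) ∧
        LowerBounds (Matrix.specialUnitaryGroup (Fin N) ℂ) r a ∧ MomentBounds6 (Matrix.specialUnitaryGroup (Fin N) ℂ) r a) ∧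
    (∀ (G : Type) [Group G] [TopologicalSpace G] [IsTopologicalGroup G] [CompactSpace G],
      IsCompactSimpleLieGroup G → (∀ N : ℕ, 2 ≤ N → IsEmpty (G ≃ₜ* Matrix.specialUnitaryGroup (Fin N) ℂ)) →
      letI : MeasurableSpace G := borel G; haveI : BorelSpace G := ⟨rfl⟩;
      ∃ (r : LatticeRep G) (a : ℝ → ℝ), (∀ β, 0 < a β) ∧ Tendsto a atTop (𝓝 0) ∧ LowerBounds G r a ∧ MomentBounds6 G r a) :=
  ⟨fun h => ⟨fun G _ _ _ _ hG _ => h G hG, fun _ _ hN => legsWitness_sun_of_legsWitnessAll h (by omega), nonSUNRec_of_legsWitnessAll h⟩,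
    fun h => legsWitnessAll_of_classes h.1 h.2.1 h.2.2⟩

/-- **The `SU(2)`-class component from the spine**: `UV` (Bałaban's apex package at the datum of record) and `UVSeamRec` (the seam in witness
form at the unit of record `uRec`) give the legs witness for every compact simple `G ≃ₜ* SU(2)` — `closes`' first branch, by name
(`uRec > 0`, `uRec → 0`: `UnitTransfer.uRec_pos` ∕ `tendsto_uRec`). -/
theorem legsWitness_su2Class_of_uv_uvSeamRec (hUV : Summit.QuantumFields.YangMills.Theses.BalabanLadder.UV)
    (hSeam : Summit.QuantumFields.YangMills.Theses.BalabanLadder.UVSeamRec) :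
    ∀ (G : Type) [Group G] [TopologicalSpace G] [IsTopologicalGroup G] [CompactSpace G],
      IsCompactSimpleLieGroup G → Nonempty (G ≃ₜ* Matrix.specialUnitaryGroup (Fin 2) ℂ) →
      letI : MeasurableSpace G := borel G; haveI : BorelSpace G := ⟨rfl⟩;
      ∃ (r : LatticeRep G) (a : ℝ → ℝ), (∀ β, 0 < a β) ∧ Tendsto a atTop (𝓝 0) ∧ LowerBounds G r a ∧ MomentBounds6 G r a := by
  intro G _ _ _ _ hG hcl
  letI : MeasurableSpace G := borel G
  haveI : BorelSpace G := ⟨rfl⟩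
  obtain ⟨r, hlb, hmb⟩ := hSeam hUV G hG hcl
  exact ⟨r, uRec, Summit.QuantumFields.YangMills.Cruxes.UVSeamRec.UnitTransfer.uRec_pos,
    Summit.QuantumFields.YangMills.Cruxes.UVSeamRec.UnitTransfer.tendsto_uRec, hlb, hmb⟩

/-- **The `SU(N ≥ 3)` component from the adopted pieces**: the apex keys `∀ N ≥ 3, UVD59 N` (the edit's `UVApexSUN`) and `UVSeamWitnessSUN`
give the legs witness AT `SU(N)` for every `N ≥ 3`. -/
theorem legsWitness_sun_of_apex_witnessSUN (hApex : ∀ (N : ℕ) [NeZero N], 3 ≤ N → YMDAG.UVSplit.UVD59 N) (hWit : UVSeamWitnessSUN)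
    (N : ℕ) [NeZero N] (hN : 3 ≤ N) :
    ∃ (r : LatticeRep (Matrix.specialUnitaryGroup (Fin N) ℂ)) (a : ℝ → ℝ), (∀ β, 0 < a β) ∧ Tendsto a atTop (𝓝 0) ∧
      LowerBounds (Matrix.specialUnitaryGroup (Fin N) ℂ) r a ∧ MomentBounds6 (Matrix.specialUnitaryGroup (Fin N) ℂ) r a :=
  hWit N hN (hApex N hN)

/-- **The all-groups legs witness from the R85 pieces** (the route owner's pre-certified `legs_of_items`, `R85_closes_preview.lean`, in the
tree): `UV → UVSeamRec → (∀ N ≥ 3, UVD59 N) → UVSeamWitnessSUN → ⟨non-SU(N) record residual⟩ →` «for every compact simple `G` some `(r, a)`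
carries floors ∧ ceilings».  `NT` is consumed nowhere.  Conditional on all five hypotheses; nothing is discharged. -/
theorem legsWitnessAll_of_recordSplit (hUV : Summit.QuantumFields.YangMills.Theses.BalabanLadder.UV)
    (hSeam : Summit.QuantumFields.YangMills.Theses.BalabanLadder.UVSeamRec)
    (hApex : ∀ (N : ℕ) [NeZero N], 3 ≤ N → YMDAG.UVSplit.UVD59 N) (hWit : UVSeamWitnessSUN)
    (hNonRec : ∀ (G : Type) [Group G] [TopologicalSpace G] [IsTopologicalGroup G] [CompactSpace G],
      IsCompactSimpleLieGroup G → (∀ N : ℕ, 2 ≤ N → IsEmpty (G ≃ₜ* Matrix.specialUnitaryGroup (Fin N) ℂ)) →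
      letI : MeasurableSpace G := borel G; haveI : BorelSpace G := ⟨rfl⟩;
      ∃ (r : LatticeRep G) (a : ℝ → ℝ), (∀ β, 0 < a β) ∧ Tendsto a atTop (𝓝 0) ∧ LowerBounds G r a ∧ MomentBounds6 G r a) :
    ∀ (G : Type) [Group G] [TopologicalSpace G] [IsTopologicalGroup G] [CompactSpace G],
      IsCompactSimpleLieGroup G → letI : MeasurableSpace G := borel G; haveI : BorelSpace G := ⟨rfl⟩;
      ∃ (r : LatticeRep G) (a : ℝ → ℝ), (∀ β, 0 < a β) ∧ Tendsto a atTop (𝓝 0) ∧ LowerBounds G r a ∧ MomentBounds6 G r a :=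
  legsWitnessAll_of_classes (legsWitness_su2Class_of_uv_uvSeamRec hUV hSeam) (legsWitness_sun_of_apex_witnessSUN hApex hWit) hNonRec

/-! ## §4 The edit's deciding-theorem body with `ROT` rev 2 (infrared guard) -/

/-- **`YangMills` from the all-record split with `ROT` rev 2** — the route owner's pre-certified `closes_R85` in the tree: SEVEN binders
`UV` · `UVSeamRec` · (`∀ N ≥ 3, UVD59 N`) · `UVSeamWitnessSUN` · ⟨non-SU(N) record residual⟩ · `IR` · ⟨`ROT` with the infrared guard, the
`hROT` binder type of `Theorems.ROT.closes_of_rotIR`⟩ ⊢ `YangMills`, through `Y2Bridge.yangMills_of_legs`; `IR` is threaded before the rotation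
leg.  Conditional on all seven hypotheses; nothing is discharged; not a route (the spine's `closes` is unchanged until the edit). -/
theorem yangMills_of_recordSplit_rotIR (hUV : Summit.QuantumFields.YangMills.Theses.BalabanLadder.UV)
    (hSeam : Summit.QuantumFields.YangMills.Theses.BalabanLadder.UVSeamRec)
    (hApex : ∀ (N : ℕ) [NeZero N], 3 ≤ N → YMDAG.UVSplit.UVD59 N) (hWit : UVSeamWitnessSUN)
    (hNonRec : ∀ (G : Type) [Group G] [TopologicalSpace G] [IsTopologicalGroup G] [CompactSpace G],
      IsCompactSimpleLieGroup G → (∀ N : ℕ, 2 ≤ N → IsEmpty (G ≃ₜ* Matrix.specialUnitaryGroup (Fin N) ℂ)) →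
      letI : MeasurableSpace G := borel G; haveI : BorelSpace G := ⟨rfl⟩;
      ∃ (r : LatticeRep G) (a : ℝ → ℝ), (∀ β, 0 < a β) ∧ Tendsto a atTop (𝓝 0) ∧ LowerBounds G r a ∧ MomentBounds6 G r a)
    (hIR : Summit.QuantumFields.YangMills.Theses.BalabanLadder.IR)
    (hROT : ∀ (G : Type) [Group G] [TopologicalSpace G] [IsTopologicalGroup G] [CompactSpace G],
      IsCompactSimpleLieGroup G → letI : MeasurableSpace G := borel G; haveI : BorelSpace G := ⟨rfl⟩;
      ∀ (r : LatticeRep G) (a : ℝ → ℝ), (∀ β, 0 < a β) → Tendsto a atTop (𝓝 0) →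
        LowerBounds G r a → MomentBounds6 G r a → GapInUnits G r a → LatticeRotWard G r a) :
    YangMills := by
  refine yangMills_of_legs ?_
  intro G _ _ _ _ hG
  letI : MeasurableSpace G := borel G
  haveI : BorelSpace G := ⟨rfl⟩
  obtain ⟨r, a, ha, ha0, hlb, hmb⟩ := legsWitnessAll_of_recordSplit hUV hSeam hApex hWit hNonRec G hG
  have hir := hIR G hG r a ha ha0 hlb
  exact ⟨r, a, ha, ha0, hmb, hlb, hir, hROT G hG r a ha ha0 hlb hmb hir⟩

/-- **Monotonicity of the edit**: today's registered items (`UV`, `UVSeamRec`, `NT`, `IR`, `ROT` rev 1, the ∀-shape residual `UVNonSUN`) with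
the apex keys and `UVSeamWitnessSUN` give the seven-binder shape — the old pair (`NT`, `UVNonSUN`) implies the record residual, and `ROT` rev 1
implies the guarded rev 2 (`Theorems.ROT.rotIR_of_rot`).  Nothing proved under the old items is lost. -/
theorem yangMills_of_recordSplit_rotIR_of_current (hUV : Summit.QuantumFields.YangMills.Theses.BalabanLadder.UV)
    (hSeam : Summit.QuantumFields.YangMills.Theses.BalabanLadder.UVSeamRec)
    (hApex : ∀ (N : ℕ) [NeZero N], 3 ≤ N → YMDAG.UVSplit.UVD59 N) (hWit : UVSeamWitnessSUN)
    (hNT : Summit.QuantumFields.YangMills.Theses.BalabanLadder.NT) (hNon : UVNonSUN)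
    (hIR : Summit.QuantumFields.YangMills.Theses.BalabanLadder.IR) (hROT : Summit.QuantumFields.YangMills.Theses.BalabanLadder.ROT) :
    YangMills := by
  refine yangMills_of_recordSplit_rotIR hUV hSeam hApex hWit ?_ hIR (Summit.QuantumFields.YangMills.Theorems.ROT.rotIR_of_rot hROT)
  intro G _ _ _ _ hG hno
  letI : MeasurableSpace G := borel G
  haveI : BorelSpace G := ⟨rfl⟩
  obtain ⟨r, a, ha, ha0, hlb⟩ := hNT G hG
  exact ⟨r, a, ha, ha0, hlb, hNon G hG hno r a ha ha0 hlb⟩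

/-! ## §5 Stating the `SU(N)` piece AT the matrix group loses nothing (appended 2026-08-26)

The legs witness is invariant under topological-group isomorphisms of compact groups (Haar transport both ways, any Borel-type instances on
either side), so the R85 piece `UVSeamWitnessSUN`, stated AT `Matrix.specialUnitaryGroup (Fin N) ℂ` over the tree's instances, is EQUIVALENT to
its on-class form «for every compact `G ≃ₜ* SU(N)` (Borel σ-algebra), under the apex key, some `(r, a)` carries floors ∧ ceilings of `G`». -/

section WitnessTransport

variable {G H : Type} [Group G] [TopologicalSpace G] [IsTopologicalGroup G] [CompactSpace G]
  [MeasurableSpace G] [BorelSpace G]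
  [Group H] [TopologicalSpace H] [IsTopologicalGroup H] [CompactSpace H]
  [MeasurableSpace H] [BorelSpace H]

/-- **The legs witness is invariant under `G ≃ₜ* H`** (compact groups, any Borel structures): `legsWitness_of_continuousMulEquiv` both ways. -/
theorem legsWitness_iff_of_continuousMulEquiv (e : G ≃ₜ* H) :
    (∃ (r : LatticeRep G) (a : ℝ → ℝ), (∀ β, 0 < a β) ∧ Tendsto a atTop (𝓝 0) ∧ LowerBounds G r a ∧ MomentBounds6 G r a) ↔
      ∃ (r : LatticeRep H) (a : ℝ → ℝ), (∀ β, 0 < a β) ∧ Tendsto a atTop (𝓝 0) ∧ LowerBounds H r a ∧ MomentBounds6 H r a :=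
  ⟨legsWitness_of_continuousMulEquiv e.symm, legsWitness_of_continuousMulEquiv e⟩

end WitnessTransport

/-- **`UVSeamWitnessSUN` ↔ its on-class form**: for every `N ≥ 3`, under the apex key `UVD59 N`, «some `(r, a)` carries floors ∧ ceilings of
`SU(N)`» (tree instances) iff «for every compact `G ≃ₜ* SU(N)` with its Borel σ-algebra, some `(r, a)` carries floors ∧ ceilings of `G`»
(forward: transport along `e`; backward: `G := SU(N)`, `e := ContinuousMulEquiv.refl`, transporting between the two instance choices). -/
theorem uvSeamWitnessSUN_iff_onClass :
    UVSeamWitnessSUN ↔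
      ∀ (N : ℕ) [NeZero N], 3 ≤ N → YMDAG.UVSplit.UVD59 N →
        ∀ (G : Type) [Group G] [TopologicalSpace G] [IsTopologicalGroup G] [CompactSpace G],
          Nonempty (G ≃ₜ* Matrix.specialUnitaryGroup (Fin N) ℂ) →
          letI : MeasurableSpace G := borel G; haveI : BorelSpace G := ⟨rfl⟩;
          ∃ (r : LatticeRep G) (a : ℝ → ℝ), (∀ β, 0 < a β) ∧ Tendsto a atTop (𝓝 0) ∧ LowerBounds G r a ∧ MomentBounds6 G r a := by
  constructor
  · intro h N _ hN hD G _ _ _ _ hne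
    letI : MeasurableSpace G := borel G
    haveI : BorelSpace G := ⟨rfl⟩
    obtain ⟨e⟩ := hne
    exact legsWitness_of_continuousMulEquiv e (h N hN hD)
  · intro h N _ hN hD
    have hSU := h N hN hD (Matrix.specialUnitaryGroup (Fin N) ℂ) ⟨ContinuousMulEquiv.refl _⟩
    exact legsWitness_of_continuousMulEquiv (ContinuousMulEquiv.refl _) hSU

/-- **On the `SU(N ≥ 3)` class the guard `IsCompactSimpleLieGroup G` is redundant and the `SU(2)` guard automatic**: the on-class form of
`UVSeamWitnessSUN` may equivalently carry the bridge's guard (every `G ≃ₜ* SU(N)` is compact simple Lie, `isCompactSimpleLieGroup_of_equiv_sun`). -/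
theorem uvSeamWitnessSUN_iff_onClass_guarded :
    UVSeamWitnessSUN ↔
      ∀ (N : ℕ) [NeZero N], 3 ≤ N → YMDAG.UVSplit.UVD59 N →
        ∀ (G : Type) [Group G] [TopologicalSpace G] [IsTopologicalGroup G] [CompactSpace G],
          IsCompactSimpleLieGroup G → Nonempty (G ≃ₜ* Matrix.specialUnitaryGroup (Fin N) ℂ) →
          letI : MeasurableSpace G := borel G; haveI : BorelSpace G := ⟨rfl⟩;
          ∃ (r : LatticeRep G) (a : ℝ → ℝ), (∀ β, 0 < a β) ∧ Tendsto a atTop (𝓝 0) ∧ LowerBounds G r a ∧ MomentBounds6 G r a := by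
  rw [uvSeamWitnessSUN_iff_onClass]
  constructor
  · exact fun h N _ hN hD G _ _ _ _ _ hne => h N hN hD G hne
  · intro h N _ hN hD G _ _ _ _ hne
    obtain ⟨e⟩ := hne
    exact h N hN hD G (isCompactSimpleLieGroup_of_equiv_sun (by omega) e) ⟨e⟩

end Summit.QuantumFields.YangMills.Theorems.UVOtherGroups

end
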